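import Summits.Ventures.PercRepro.RankLevelSetUpFiveSeries

/-! # RankLevelSetUpFiveMem — (↑) AT LEVEL `5` AT AN ELEMENT OF A SERIES CLASS OF SIZE `≥ 4` (night-1 g40; dossier
§52; on `RankLevelSetUpFiveSeries`)

For `N = M✶` loopless of rank `4`, `P = cl {p}` and `b ∈ P`, a bi-spanning `5`-set through `b` meets `P` in `{b}` or
in `{b, x}` (`not_three_parallel_of_spanning_five`), so `W ↦ W ∖ P` and `W ↦ ((W ∩ P) ∖ {b}, W ∖ P)` give
**`through_five_le_of_mem`**: `T_5 ≤ 𝒢_4 + (q − 1) · 𝒢_3`, where `𝒢_k = avoidHat N p b k` is the family of ALL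
bi-spanning `k`-sets of the contraction `N ／ P` (the avoid-`b` condition is void for `b ∈ P`). On the other side the
sets `D ∪ S` with `S ⊆ P ∖ {b}`, `#S = s ∈ {1, 2, 3}` and `D ∈ 𝒢_{6−s}` are pairwise distinct bi-spanning `6`-sets
avoiding `b` — **`avoid_six_ge_of_mem`**: `(q − 1) 𝒢_5 + C(q−1, 2) 𝒢_4 + C(q−1, 3) 𝒢_3 ≤ V_6`. For `q − 1 ≥ 4`
the second bound dominates the first term by term (`C(q−1, 3) ≥ q − 1`, **`le_choose_three`**); for `q − 1 = 3` the
difference is `2 𝒢_3 ≤ 2 𝒢_4 + 3 𝒢_5`, i.e. the step `j = 3` of Mono on the nullity-`3` deletion `M ＼ P` with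
`#E ∖ P ≥ 8` (`biIndepMono_of_nullity`). Hence **`upAt_five_of_mem_seriesClass`**: `M` coloop-free of nullity `4`,
`#cl✶ {p} ≥ 4`, `b ∈ cl✶ {p}`, `12 ≤ #E` ⟹ `BiIndepUpAt M b 5`. Every declaration has a docstring; imports: the
cell's own modules and Mathlib only. Axioms: standard. -/

namespace PercRepro

open Set Matroid

variable {α : Type} (N : Matroid α) [N.Finite]

/-! ## Arithmetic -/

/-- `n ≤ C(n, 3)` for `n ≥ 4`: `C(4,3) = 4` and `C(n+1, 3) = C(n, 2) + C(n, 3) ≥ 1 + n`. -/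
lemma le_choose_three (n : ℕ) (hn : 4 ≤ n) : n ≤ n.choose 3 := by
  induction n with
  | zero => omega
  | succ m ih =>
    rcases Nat.lt_or_ge m 4 with hm | hm
    · have : m = 3 := by omega
      subst this; decide
    · have h1 := ih hm
      have h2 : 1 ≤ m.choose 2 := Nat.choose_pos (by omega)
      have h3 : (m + 1).choose 3 = m.choose 2 + m.choose 3 := Nat.choose_succ_succ m 2
      omega

/-! ## The through-`b` side, `b ∈ P` -/

/-- **THE THROUGH-`b` SIDE AT LEVEL `5` FOR `b` IN THE CLASS**: `T_5 ≤ 𝒢_4 + (q − 1) · 𝒢_3` — a bi-spanning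
`5`-set through `b ∈ P` meets `P` in `{b}` or in a pair `{b, x}` (`not_three_parallel_of_spanning_five`); the
former inject into `𝒢_4` by `W ↦ W ∖ P`, the latter into `{x} × 𝒢_3` by `W ↦ ((W ∩ P) ∖ {b}, W ∖ P)`, where
`𝒢_k = avoidHat N p b k` (for `b ∈ P` the condition `b ∉ D` is void). Needs `#P ≥ 3`. -/
theorem through_five_le_of_mem (hnl : ∀ e ∈ N.E, N.IsNonloop e) (hr : N.eRank = 4) {p : α} (hp : p ∈ N.E)
    (hq : 3 ≤ (N.closure {p}).ncard) {b : α} (hbP : b ∈ N.closure {p}) :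
    {W ∈ biSpan N 5 | b ∈ W}.ncard ≤
      (avoidHat N p b 4).ncard + (N.closure {p} \ {b}).ncard * (avoidHat N p b 3).ncard := by
  classical
  set P := N.closure {p} with hPdef
  have hPE : P ⊆ N.E := N.closure_subset_ground _
  have hpnl : N.IsNonloop p := hnl p hp
  have hPfin : P.Finite := N.ground_finite.subset hPE
  have hPbfin : (P \ {b}).Finite := hPfin.subset Set.sdiff_subset
  set T := {W ∈ biSpan N 5 | b ∈ W} with hT
  set T₁ := {W ∈ T | W ∩ P = {b}} with hT₁
  set T₂ := {W ∈ T | W ∩ P ≠ {b}} with hT₂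
  have hTfin : T.Finite := N.ground_finite.finite_subsets.subset (fun _ h => h.1.1)
  have hsplit : T = T₁ ∪ T₂ := by
    ext W; simp only [hT₁, hT₂, Set.mem_union, Set.mem_setOf_eq]; tauto
  -- the complement of `W` along `P`
  have hcompl : ∀ W : Set α, N.E \ W = ((N.E \ P) \ (W \ P)) ∪ (P \ W) := fun W =>
    compl_eq_sdiff_union N hPE
  -- the spanning conditions of `W ∖ P` for a member `W` of `T` whose trace on `P` has `< #P` elements
  have hmem : ∀ W ∈ T, (W ∩ P).ncard < P.ncard →
      W \ P ⊆ N.E \ P ∧ (W \ P).ncard = 5 - (W ∩ P).ncard ∧ b ∉ W \ P ∧ N.Spanning (insert p (W \ P)) ∧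
        N.Spanning (insert p ((N.E \ P) \ (W \ P))) := by
    rintro W ⟨⟨hWE, hW5, hWs, hWc⟩, hbW⟩ hlt
    have hWfin : W.Finite := N.ground_finite.subset hWE
    have hWP : (W ∩ P).Nonempty := ⟨b, hbW, hbP⟩
    refine ⟨fun x hx => ⟨hWE hx.1, hx.2⟩, ?_, fun h => h.2 hbP, ?_, ?_⟩
    · have h := Set.ncard_inter_add_ncard_sdiff_eq_ncard W P hWfin
      omega
    · have hW' : W = (W \ P) ∪ (W ∩ P) := by rw [Set.sdiff_union_inter]
      rw [hW'] at hWs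
      exact (spanning_union_iff_insert N hnl hpnl Set.inter_subset_right hWP
        (Set.sdiff_subset.trans hWE)).mp hWs
    · rw [hcompl W] at hWc
      have hne : (P \ W).Nonempty := by
        by_contra hemp
        rw [Set.not_nonempty_iff_eq_empty, Set.sdiff_eq_empty] at hemp
        have : P ⊆ W ∩ P := fun y hy => ⟨hemp hy, hy⟩
        have hle := Set.ncard_le_ncard this (hWfin.subset Set.inter_subset_left)
        omega
      exact (spanning_union_iff_insert N hnl hpnl Set.sdiff_subset hne
        (Set.sdiff_subset.trans Set.sdiff_subset)).mp hWc
  -- the trace of a member of `T₂` is a pair `{b, x}`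
  have htrace : ∀ W ∈ T₂, ∃ x, x ≠ b ∧ W ∩ P = {b, x} := by
    rintro W ⟨⟨⟨hWE, hW5, hWs, hWc⟩, hbW⟩, hWP⟩
    have hsub : {b} ⊆ W ∩ P := Set.singleton_subset_iff.mpr ⟨hbW, hbP⟩
    obtain ⟨x, hx, hxb⟩ : ∃ x ∈ W ∩ P, x ∉ ({b} : Set α) := by
      by_contra hno
      exact hWP (subset_antisymm (fun x hx => by_contra fun hxb => hno ⟨x, hx, hxb⟩) hsub)
    rw [Set.mem_singleton_iff] at hxb
    refine ⟨x, hxb, ?_⟩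
    ext y
    simp only [Set.mem_insert_iff, Set.mem_singleton_iff]
    constructor
    · intro hy
      by_contra hyn
      obtain ⟨hyb, hyx⟩ := not_or.mp hyn
      exact not_three_parallel_of_spanning_five hnl hr hWs hW5 (p := p) hy.1 hbW hx.1 hyb hyx
        (Ne.symm hxb) hy.2 hbP hx.2
    · rintro (rfl | rfl)
      · exact ⟨hbW, hbP⟩
      · exact hx
  have h1 : T₁.ncard ≤ (avoidHat N p b 4).ncard := by
    refine Set.ncard_le_ncard_of_injOn (fun W => W \ P) ?_ ?_ (avoidHat_finite N p b 4)
    · rintro W ⟨hWT, hWP⟩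
      have hc1 : (W ∩ P).ncard = 1 := by rw [hWP, Set.ncard_singleton]
      obtain ⟨h1, h2, h3, h4, h5⟩ := hmem W hWT (by omega)
      exact ⟨h1, by rw [h2, hc1], h3, h4, h5⟩
    · rintro W ⟨-, hWP⟩ W' ⟨-, hW'P⟩ heq
      simp only at heq
      rw [← Set.inter_union_sdiff W P, ← Set.inter_union_sdiff W' P, hWP, hW'P, heq]
  have h2 : T₂.ncard ≤ (P \ {b}).ncard * (avoidHat N p b 3).ncard := by
    have hprod : ({S | S ⊆ P \ {b} ∧ S.ncard = 1} ×ˢ avoidHat N p b 3).ncard =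
        (P \ {b}).ncard * (avoidHat N p b 3).ncard := by
      rw [Set.ncard_prod, Set.ncard_powerset_ncard hPbfin, Nat.choose_one_right]
    rw [← hprod]
    refine Set.ncard_le_ncard_of_injOn (fun W => ((W ∩ P) \ {b}, W \ P)) ?_ ?_
      ((hPbfin.finite_subsets.subset (fun _ h => h.1)).prod (avoidHat_finite N p b 3))
    · intro W hW
      obtain ⟨x, hxb, hWP⟩ := htrace W hW
      have hc2 : (W ∩ P).ncard = 2 := by rw [hWP, Set.ncard_pair (Ne.symm hxb)]
      obtain ⟨h1, h2, h3, h4, h5⟩ := hmem W hW.1 (by omega)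
      refine Set.mem_prod.mpr ⟨⟨fun y hy => ⟨hy.1.2, hy.2⟩, ?_⟩, h1, by rw [h2, hc2], h3, h4, h5⟩
      have : (W ∩ P) \ {b} = {x} := by
        rw [hWP]
        ext y
        simp only [Set.mem_sdiff, Set.mem_insert_iff, Set.mem_singleton_iff]
        constructor
        · rintro ⟨rfl | rfl, hyb⟩
          · exact absurd rfl hyb
          · rfl
        · rintro rfl; exact ⟨Or.inr rfl, hxb⟩
      rw [this, Set.ncard_singleton]
    · rintro W hW W' hW' heq
      simp only [Prod.mk.injEq] at heq
      have hbWP : ({b} : Set α) ⊆ W ∩ P := Set.singleton_subset_iff.mpr ⟨hW.1.2, hbP⟩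
      have hbW'P : ({b} : Set α) ⊆ W' ∩ P := Set.singleton_subset_iff.mpr ⟨hW'.1.2, hbP⟩
      have hb1 : W ∩ P = ((W ∩ P) \ {b}) ∪ {b} := (Set.sdiff_union_of_subset hbWP).symm
      have hb2 : W' ∩ P = ((W' ∩ P) \ {b}) ∪ {b} := (Set.sdiff_union_of_subset hbW'P).symm
      rw [← Set.inter_union_sdiff W P, ← Set.inter_union_sdiff W' P, hb1, hb2, heq.1, heq.2]
  calc T.ncard = (T₁ ∪ T₂).ncard := by rw [hsplit]
    _ ≤ T₁.ncard + T₂.ncard := Set.ncard_union_le _ _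
    _ ≤ _ := Nat.add_le_add h1 h2

/-! ## The avoid-`b` side, `b ∈ P` -/

/-- **THE AVOID-`b` SIDE AT LEVEL `6` FOR `b` IN THE CLASS**: `(q − 1) 𝒢_5 + C(q−1, 2) 𝒢_4 + C(q−1, 3) 𝒢_3 ≤ V_6`
— the sets `D ∪ S` with `S ⊆ P ∖ {b}`, `#S = s ∈ {1, 2, 3}`, `D ∈ 𝒢_{6−s} = avoidHat N p b (6 − s)` are pairwise
distinct bi-spanning `6`-sets avoiding `b` (sorted by `#(Z ∩ P)`); their complements contain `b ∈ P ∖ S`. -/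
theorem avoid_six_ge_of_mem (hnl : ∀ e ∈ N.E, N.IsNonloop e) {p : α} (hp : p ∈ N.E) {b : α}
    (hbP : b ∈ N.closure {p}) :
    (N.closure {p} \ {b}).ncard * (avoidHat N p b 5).ncard +
      (N.closure {p} \ {b}).ncard.choose 2 * (avoidHat N p b 4).ncard +
      (N.closure {p} \ {b}).ncard.choose 3 * (avoidHat N p b 3).ncard ≤ {Z ∈ biSpan N 6 | b ∉ Z}.ncard := by
  classical
  set P := N.closure {p} with hPdef
  have hPE : P ⊆ N.E := N.closure_subset_ground _
  have hpnl : N.IsNonloop p := hnl p hp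
  have hPfin : P.Finite := N.ground_finite.subset hPE
  have hPbfin : (P \ {b}).Finite := hPfin.subset Set.sdiff_subset
  set V := {Z ∈ biSpan N 6 | b ∉ Z} with hV
  have hVfin : V.Finite := N.ground_finite.finite_subsets.subset (fun _ h => h.1.1)
  -- the pieces, sorted by `#(Z ∩ P)`
  let Vk : ℕ → Set (Set α) := fun k => {Z ∈ V | (Z ∩ P).ncard = k}
  have hVk : ∀ k, Vk k ⊆ V := fun k _ h => h.1
  have hdisj : ∀ k l, k ≠ l → Disjoint (Vk k) (Vk l) := by
    intro k l hkl
    rw [Set.disjoint_left]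
    rintro Z ⟨-, hk⟩ ⟨-, hl⟩
    exact hkl (hk.symm.trans hl)
  -- the injection `(S, D) ↦ D ∪ S` for `S ⊆ P ∖ {b}`, `#S = s`, `D ∈ avoidHat (6 - s)`
  have hinj : ∀ s : ℕ, 1 ≤ s → s ≤ 6 →
      ({S | S ⊆ P \ {b} ∧ S.ncard = s} ×ˢ avoidHat N p b (6 - s)).ncard ≤ (Vk s).ncard := by
    intro s hs1 hs6
    refine Set.ncard_le_ncard_of_injOn (fun x => x.2 ∪ x.1) ?_ ?_ (hVfin.subset (hVk s))
    · rintro ⟨S, D⟩ hx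
      obtain ⟨hx1, hx2⟩ := Set.mem_prod.mp hx
      dsimp only at hx1 hx2
      obtain ⟨hSPb, hSs⟩ := hx1
      obtain ⟨hDE, hDk, hbD, hDs, hDc⟩ := hx2
      simp only
      have hSP : S ⊆ P := hSPb.trans Set.sdiff_subset
      have hDfin : D.Finite := N.ground_finite.subset (hDE.trans Set.sdiff_subset)
      have hSfin : S.Finite := hPfin.subset hSP
      have hdj : Disjoint D S := by
        rw [Set.disjoint_left]
        intro x hxD hxS
        exact (hDE hxD).2 (hSP hxS)
      have hSne : S.Nonempty := by
        rw [← Set.ncard_pos hSfin]; omega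
      have hbS : b ∉ S := fun h => (hSPb h).2 rfl
      have hPSne : (P \ S).Nonempty := ⟨b, hbP, hbS⟩
      refine ⟨⟨⟨Set.union_subset (hDE.trans Set.sdiff_subset) (hSP.trans hPE), ?_, ?_, ?_⟩, ?_⟩, ?_⟩
      · rw [Set.ncard_union_eq hdj hDfin hSfin, hDk, hSs]; omega
      · exact (spanning_union_iff_insert N hnl hpnl hSP hSne (hDE.trans Set.sdiff_subset)).mpr hDs
      · rw [compl_union_eq N hPE hDE hSP]
        exact (spanning_union_iff_insert N hnl hpnl Set.sdiff_subset hPSne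
          (Set.sdiff_subset.trans Set.sdiff_subset)).mpr hDc
      · rintro (hbD' | hbS')
        · exact hbD hbD'
        · exact hbS hbS'
      · have : (D ∪ S) ∩ P = S := by
          ext x
          simp only [Set.mem_inter_iff, Set.mem_union]
          constructor
          · rintro ⟨hx | hx, hxP⟩
            · exact absurd hxP (hDE hx).2
            · exact hx
          · intro hx; exact ⟨Or.inr hx, hSP hx⟩
        rw [this, hSs]
    · rintro ⟨S, D⟩ hx ⟨S', D'⟩ hx' heq
      obtain ⟨hx1, hx2⟩ := Set.mem_prod.mp hx
      obtain ⟨hx1', hx2'⟩ := Set.mem_prod.mp hx'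
      dsimp only at hx1 hx2 hx1' hx2'
      have hSP : S ⊆ P := hx1.1.trans Set.sdiff_subset
      have hDE : D ⊆ N.E \ P := hx2.1
      have hS'P : S' ⊆ P := hx1'.1.trans Set.sdiff_subset
      have hD'E : D' ⊆ N.E \ P := hx2'.1
      simp only at heq
      have hS : S = (D ∪ S) ∩ P := by
        ext x; simp only [Set.mem_inter_iff, Set.mem_union]
        constructor
        · intro hx; exact ⟨Or.inr hx, hSP hx⟩
        · rintro ⟨hx | hx, hxP⟩
          · exact absurd hxP (hDE hx).2
          · exact hx
      have hS' : S' = (D' ∪ S') ∩ P := by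
        ext x; simp only [Set.mem_inter_iff, Set.mem_union]
        constructor
        · intro hx; exact ⟨Or.inr hx, hS'P hx⟩
        · rintro ⟨hx | hx, hxP⟩
          · exact absurd hxP (hD'E hx).2
          · exact hx
      have hD : D = (D ∪ S) \ P := by
        ext x; simp only [Set.mem_sdiff, Set.mem_union]
        constructor
        · intro hx; exact ⟨Or.inl hx, (hDE hx).2⟩
        · rintro ⟨hx | hx, hxP⟩
          · exact hx
          · exact absurd (hSP hx) hxP
      have hD' : D' = (D' ∪ S') \ P := by
        ext x; simp only [Set.mem_sdiff, Set.mem_union]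
        constructor
        · intro hx; exact ⟨Or.inl hx, (hD'E hx).2⟩
        · rintro ⟨hx | hx, hxP⟩
          · exact hx
          · exact absurd (hS'P hx) hxP
      rw [Prod.mk.injEq]
      exact ⟨by rw [hS, hS', heq], by rw [hD, hD', heq]⟩
  have h1 := hinj 1 le_rfl (by norm_num)
  have h2 := hinj 2 (by norm_num) (by norm_num)
  have h3 := hinj 3 (by norm_num) (by norm_num)
  rw [Set.ncard_prod, Set.ncard_powerset_ncard hPbfin, Nat.choose_one_right] at h1
  rw [Set.ncard_prod, Set.ncard_powerset_ncard hPbfin] at h2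
  rw [Set.ncard_prod, Set.ncard_powerset_ncard hPbfin] at h3
  have hunion : (Vk 1 ∪ Vk 2 ∪ Vk 3).ncard = (Vk 1).ncard + (Vk 2).ncard + (Vk 3).ncard := by
    rw [Set.ncard_union_eq ?_ ((hVfin.subset (hVk 1)).union (hVfin.subset (hVk 2))) (hVfin.subset (hVk 3)),
      Set.ncard_union_eq (hdisj 1 2 (by norm_num)) (hVfin.subset (hVk 1)) (hVfin.subset (hVk 2))]
    exact Set.disjoint_union_left.mpr ⟨hdisj 1 3 (by norm_num), hdisj 2 3 (by norm_num)⟩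
  calc (P \ {b}).ncard * (avoidHat N p b 5).ncard + (P \ {b}).ncard.choose 2 * (avoidHat N p b 4).ncard +
        (P \ {b}).ncard.choose 3 * (avoidHat N p b 3).ncard
      ≤ (Vk 1).ncard + (Vk 2).ncard + (Vk 3).ncard := by
        have e1 : 6 - 1 = 5 := rfl
        have e2 : 6 - 2 = 4 := rfl
        have e3 : 6 - 3 = 3 := rfl
        rw [e1] at h1; rw [e2] at h2; rw [e3] at h3
        omega
    _ = (Vk 1 ∪ Vk 2 ∪ Vk 3).ncard := hunion.symm
    _ ≤ V.ncard := Set.ncard_le_ncard (Set.union_subset (Set.union_subset (hVk 1) (hVk 2)) (hVk 3)) hVfin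

/-! ## The theorem -/

variable (M : Matroid α) [M.Finite]

omit [M.Finite] in
/-- **For `b` in the class, `avoidHat M✶ p b k` is the whole bi-independent family of the deletion `M ＼ cl✶ {p}`.** -/
lemma avoidHat_eq_biIndep_delete_of_mem (hcol : ∀ e, ¬ M.IsColoop e) {p : α} (hp : p ∈ M.E) {b : α}
    (hbP : b ∈ M✶.closure {p}) (k : ℕ) :
    avoidHat M✶ p b k = biIndep (M.delete (M✶.closure {p})) k := by
  rw [avoidHat_eq_biIndep_delete M hcol hp b k]
  ext U
  simp only [Set.mem_setOf_eq, and_iff_left_iff_imp]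
  intro hU hbU
  have := hU.1 hbU
  rw [Matroid.delete_ground] at this
  exact this.2 hbP

/-- **(↑) AT LEVEL `5` AT AN ELEMENT OF A SERIES CLASS OF SIZE `≥ 4`** (`M` coloop-free of nullity `4`,
`#cl✶ {p} ≥ 4`, `b ∈ cl✶ {p}`, `12 ≤ #E`): `T_5 ≤ 𝒢_4 + (q−1) 𝒢_3` and `(q−1) 𝒢_5 + C(q−1,2) 𝒢_4 + C(q−1,3) 𝒢_3 ≤ V_6`;
for `q − 1 ≥ 4` termwise (`C(q−1,3) ≥ q − 1`), for `q − 1 = 3` via `𝒢_3 ≤ 𝒢_4` (Mono's step `3` of the nullity-`3`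
deletion `M ＼ cl✶ {p}`, which has `≥ 8` elements). -/
theorem upAt_five_of_mem_seriesClass (hcol : ∀ e, ¬ M.IsColoop e) (hν : M✶.eRank = 4) {p : α} (hp : p ∈ M.E)
    (hq : 4 ≤ (M✶.closure {p}).ncard) {b : α} (hbP : b ∈ M✶.closure {p}) (hn : 12 ≤ M.E.ncard) :
    BiIndepUpAt M b 5 := by
  classical
  have hnl := dual_isNonloop_of_coloopFree' M hcol
  have hpE : p ∈ M✶.E := by rwa [Matroid.dual_ground]
  have hpnl : M✶.IsNonloop p := hnl p hpE
  have hPE : M✶.closure {p} ⊆ M✶.E := M✶.closure_subset_ground _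
  have hPfin : (M✶.closure {p}).Finite := M✶.ground_finite.subset hPE
  have hPb : (M✶.closure {p} \ {b}).ncard + 1 = (M✶.closure {p}).ncard := by
    rw [Set.ncard_sdiff_singleton_of_mem hbP]; omega
  set q' := (M✶.closure {p} \ {b}).ncard with hq'
  unfold BiIndepUpAt
  rw [biIndep_eq_biSpan_dual, biIndep_eq_biSpan_dual]
  have hT := through_five_le_of_mem M✶ hnl hν hpE (by omega) hbP
  have hV := avoid_six_ge_of_mem M✶ hnl hpE hbP
  rw [← hq'] at hT hV
  -- the families of the deletion
  have hG : ∀ k, (avoidHat M✶ p b k).ncard = biIndepCount (M.delete (M✶.closure {p})) k := fun k => by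
    rw [avoidHat_eq_biIndep_delete_of_mem M hcol hp hbP k]; rfl
  rcases Nat.lt_or_ge q' 4 with hq4 | hq4
  · -- `q' = 3`: `𝒢_3 ≤ 𝒢_4` from Mono of the deletion
    have hq3 : q' = 3 := by omega
    have hν' : (M.delete (M✶.closure {p}))✶.eRank ≤ 4 := by
      have := eRank_dual_delete_seriesClass_add_one_le M hpnl
      rw [hν] at this
      exact le_self_add.trans this
    have hPE' : M✶.closure {p} ⊆ M.E := by rw [← Matroid.dual_ground]; exact hPE
    have hcard : (M.delete (M✶.closure {p})).E.ncard = M.E.ncard - (M✶.closure {p}).ncard := by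
      rw [Matroid.delete_ground, Set.ncard_sdiff hPE' (M.ground_finite.subset hPE')]
    have hmono : (M.E.ncard - (M✶.closure {p}).ncard - 3) * biIndepCount (M.delete (M✶.closure {p})) 3 ≤
        4 * biIndepCount (M.delete (M✶.closure {p})) 4 := by
      have := biIndepMono_of_nullity (M.delete (M✶.closure {p})) hν' 3 (by rw [hcard]; omega)
      rw [hcard] at this
      exact this
    have h34 : biIndepCount (M.delete (M✶.closure {p})) 3 ≤ biIndepCount (M.delete (M✶.closure {p})) 4 := by
      have h5 : 5 * biIndepCount (M.delete (M✶.closure {p})) 3 ≤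
          (M.E.ncard - (M✶.closure {p}).ncard - 3) * biIndepCount (M.delete (M✶.closure {p})) 3 :=
        Nat.mul_le_mul_right _ (by omega)
      omega
    rw [hG 3, hG 4] at hT hV
    rw [hq3] at hT hV
    have hc2 : Nat.choose 3 2 = 3 := by decide
    have hc3 : Nat.choose 3 3 = 1 := by decide
    rw [hc2, hc3] at hV
    show {W ∈ biSpan M✶ 5 | b ∈ W}.ncard ≤ {Z ∈ biSpan M✶ 6 | b ∉ Z}.ncard
    omega
  · -- `q' ≥ 4`: termwise
    have hc3 := le_choose_three q' hq4
    have hc2 : 1 ≤ q'.choose 2 := Nat.choose_pos (by omega)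
    have hmul3 : q' * (avoidHat M✶ p b 3).ncard ≤ q'.choose 3 * (avoidHat M✶ p b 3).ncard :=
      Nat.mul_le_mul_right _ hc3
    have hmul2 : (avoidHat M✶ p b 4).ncard ≤ q'.choose 2 * (avoidHat M✶ p b 4).ncard := by
      calc (avoidHat M✶ p b 4).ncard = 1 * (avoidHat M✶ p b 4).ncard := (one_mul _).symm
        _ ≤ q'.choose 2 * (avoidHat M✶ p b 4).ncard := Nat.mul_le_mul_right _ hc2
    show {W ∈ biSpan M✶ 5 | b ∈ W}.ncard ≤ {Z ∈ biSpan M✶ 6 | b ∉ Z}.ncard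
    omega

end PercRepro
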